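import Mathlib
import HarnessLib
import Summits.Ventures.LatticeQCDFlow.Scaling.AcceptanceVolumeFloorPi

/-!
# LatticeQCDFlow / Scaling — the acceptance volume CEILING for `m` INDEPENDENT BLOCKS on a GENERAL
# space (`Measure.pi`): `acc(⊗ᵢ pᵢ, ⊗ᵢ qᵢ) ≤ acc(pⱼ, qⱼ)` for every block `j`, and the sandwich

HONEST FRAMING: exact (Metropolis-corrected) sampling algorithms for lattice gauge theory;
figures of merit are autocorrelation/cost numbers at stated couplings and volumes; no
continuum-physics claim.

Venture `LatticeQCDFlow` (cell pub-lqcd), topic `Scaling`; FANOUT row 3 (`s0-u1-a`, S0-B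
implementation A, GEN-12).  NEW WORK of the cell (elementary), the companion of
`Scaling/AcceptanceVolumeFloorPi` (imported: setting, `piDensity_facts`, the one-coordinate Fubini
`integral_mul_prod_erase_pi`, the selector split `min_le_ite_add_ite` / `ite_add_ite_eq_min`, the
FLOOR `prod_meanAccept_le_meanAccept_pi`).  SETTING as there, now with NORMALISED blocks
(`∫ pᵢ dμᵢ = ∫ qᵢ dμᵢ = 1`); still no positivity of the model and no weight ceiling.

* **`meanAccept_pi_le_meanAccept_coord`** — THE CEILING `acc(P, Q) ≤ acc(pⱼ, qⱼ)` for every block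
  `j` (hence `≤ minⱼ acc(pⱼ, qⱼ)`): bound the pair minimum `min(P(x)Q(x′), P(x′)Q(x))` by the branch
  selected by block `j`'s own pair (`min(F, G) ≤ 1[fⱼ ≤ gⱼ]·F + 1[fⱼ > gⱼ]·G`), integrate the
  other blocks out with the one-coordinate Fubini (each contributes `∫ pᵢ · ∫ qᵢ = 1`), and what is
  left is `∫∫ (1[fⱼ ≤ gⱼ] fⱼ + 1[fⱼ > gⱼ] gⱼ) dμⱼ dμⱼ = acc(pⱼ, qⱼ)` — data processing under the
  coordinate projection, written out on densities;
* **`meanAccept_pi_sandwich`** — `∏ᵢ acc(pᵢ, qᵢ) ≤ acc(⊗pᵢ, ⊗qᵢ) ≤ acc(pⱼ, qⱼ)`;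
* `meanAccept_pi_const_le` — identical blocks: `acc(p^{⊗m}, q^{⊗m}) ≤ acc(p, q)` (`m ≥ 1`).

Reading (value-free): adding an independent block to a factorised flow can only lower the
equilibrium acceptance, on any configuration space; with the floor, the acceptance of `m` identical
independent blocks lies in `[acc₁^m, acc₁]` and the effective sample size is `ESS₁^m`.  NOT CLAIMED:
any acceptance value of ours; nothing re-scored.
-/

namespace Summit.Ventures.LatticeQCDFlow.Theory2

open MeasureTheory Finset

variable {ι : Type*} [Fintype ι] {X : ι → Type*} [∀ i, MeasurableSpace (X i)]
  {μ : (i : ι) → Measure (X i)} [∀ i, SigmaFinite (μ i)]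

/-! ## The ceiling: a block can only cost acceptance -/

/-- **A BLOCK CAN ONLY COST ACCEPTANCE (`m` blocks, general space).**  For normalised nonnegative
block targets and models (`∫ pᵢ = ∫ qᵢ = 1`) and every block `j`:
`∫∫ min(P(x)Q(x′), P(x′)Q(x)) d(⊗μ) d(⊗μ) ≤ ∫∫ min(pⱼ(a)qⱼ(b), pⱼ(b)qⱼ(a)) dμⱼ dμⱼ`, i.e.
`acc(⊗pᵢ, ⊗qᵢ) ≤ acc(pⱼ, qⱼ)` — hence `≤ minⱼ acc(pⱼ, qⱼ)`.  Proof: bound the pair minimum by the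
branch selected by block `j`'s own pair (`min(F, G) ≤ 1[fⱼ ≤ gⱼ]·F + 1[fⱼ > gⱼ]·G`) and integrate
the other blocks out with the one-coordinate Fubini `integral_mul_prod_erase_pi`; what is left is
`∫∫ (1[fⱼ ≤ gⱼ] fⱼ + 1[fⱼ > gⱼ] gⱼ) = acc(pⱼ, qⱼ)`. [ours] -/
theorem meanAccept_pi_le_meanAccept_coord {p q : (i : ι) → X i → ℝ} (hp0 : ∀ i a, 0 ≤ p i a)
    (hpm : ∀ i, Measurable (p i)) (hpi : ∀ i, Integrable (p i) (μ i))
    (hp1 : ∀ i, ∫ a, p i a ∂(μ i) = 1) (hq0 : ∀ i a, 0 ≤ q i a) (hqm : ∀ i, Measurable (q i))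
    (hqi : ∀ i, Integrable (q i) (μ i)) (hq1 : ∀ i, ∫ a, q i a ∂(μ i) = 1) (j : ι) :
    ∫ x, ∫ x', min ((∏ i, p i (x i)) * ∏ i, q i (x' i)) ((∏ i, p i (x' i)) * ∏ i, q i (x i))
          ∂(Measure.pi μ) ∂(Measure.pi μ)
      ≤ ∫ a, ∫ b, min (p j a * q j b) (p j b * q j a) ∂(μ j) ∂(μ j) := by
  classical
  obtain ⟨hP0, hPm, hPi, -⟩ := piDensity_facts (μ := μ) hp0 hpm hpi
  obtain ⟨hQ0, hQm, hQi, -⟩ := piDensity_facts (μ := μ) hq0 hqm hqi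
  have hKnn : ∀ x x' : (i : ι) → X i,
      0 ≤ min ((∏ i, p i (x i)) * ∏ i, q i (x' i)) ((∏ i, p i (x' i)) * ∏ i, q i (x i)) :=
    fun x x' => le_min (mul_nonneg (hP0 _) (hQ0 _)) (mul_nonneg (hP0 _) (hQ0 _))
  -- the deciding set of block `j` and the two selector kernels `V₁ = 1[f ≤ g] f`, `V₂ = 1[f > g] g`
  have hS : MeasurableSet {e : X j × X j | p j e.1 * q j e.2 ≤ p j e.2 * q j e.1} :=
    measurableSet_le (((hpm j).comp measurable_fst).mul ((hqm j).comp measurable_snd))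
      (((hpm j).comp measurable_snd).mul ((hqm j).comp measurable_fst))
  have hV₁m : Measurable (fun e : X j × X j =>
      if p j e.1 * q j e.2 ≤ p j e.2 * q j e.1 then p j e.1 * q j e.2 else 0) :=
    Measurable.ite hS (((hpm j).comp measurable_fst).mul ((hqm j).comp measurable_snd))
      measurable_const
  have hV₂m : Measurable (fun e : X j × X j =>
      if p j e.1 * q j e.2 ≤ p j e.2 * q j e.1 then 0 else p j e.2 * q j e.1) :=
    Measurable.ite hS measurable_const
      (((hpm j).comp measurable_snd).mul ((hqm j).comp measurable_fst))
  have hV₁b : ∀ a b, 0 ≤ (if p j a * q j b ≤ p j b * q j a then p j a * q j b else 0) ∧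
      (if p j a * q j b ≤ p j b * q j a then p j a * q j b else 0) ≤ p j a * q j b := by
    intro a b
    by_cases hc : p j a * q j b ≤ p j b * q j a
    · rw [if_pos hc]; exact ⟨mul_nonneg (hp0 _ _) (hq0 _ _), le_rfl⟩
    · rw [if_neg hc]; exact ⟨le_rfl, mul_nonneg (hp0 _ _) (hq0 _ _)⟩
  have hV₂b : ∀ a b, 0 ≤ (if p j a * q j b ≤ p j b * q j a then 0 else p j b * q j a) ∧
      (if p j a * q j b ≤ p j b * q j a then 0 else p j b * q j a) ≤ p j b * q j a := by
    intro a b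
    by_cases hc : p j a * q j b ≤ p j b * q j a
    · rw [if_pos hc]; exact ⟨le_rfl, mul_nonneg (hp0 _ _) (hq0 _ _)⟩
    · rw [if_neg hc]; exact ⟨mul_nonneg (hp0 _ _) (hq0 _ _), le_rfl⟩
  -- the selector kernels are integrable on the pair space of block `j`
  have hV₁i : Integrable (fun e : X j × X j =>
      if p j e.1 * q j e.2 ≤ p j e.2 * q j e.1 then p j e.1 * q j e.2 else 0)
      ((μ j).prod (μ j)) := by
    refine Integrable.mono' ((hpi j).mul_prod (hqi j)) hV₁m.aestronglyMeasurable
      (Filter.Eventually.of_forall fun e => ?_)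
    rw [Real.norm_of_nonneg (hV₁b _ _).1]
    exact (hV₁b _ _).2
  have hV₂i : Integrable (fun e : X j × X j =>
      if p j e.1 * q j e.2 ≤ p j e.2 * q j e.1 then 0 else p j e.2 * q j e.1)
      ((μ j).prod (μ j)) := by
    have hdom : Integrable (fun e : X j × X j => p j e.2 * q j e.1) ((μ j).prod (μ j)) := by
      have h := (hqi j).mul_prod (hpi j)
      refine h.congr (Filter.Eventually.of_forall fun e => ?_)
      exact mul_comm _ _
    refine Integrable.mono' hdom hV₂m.aestronglyMeasurable (Filter.Eventually.of_forall fun e => ?_)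
    rw [Real.norm_of_nonneg (hV₂b _ _).1]
    exact (hV₂b _ _).2
  -- their sections and marginals
  have hV₁si : ∀ a, Integrable (fun b =>
      if p j a * q j b ≤ p j b * q j a then p j a * q j b else 0) (μ j) := by
    intro a
    refine Integrable.mono' ((hqi j).const_mul (p j a)) (hV₁m.comp measurable_prodMk_left).aestronglyMeasurable
      (Filter.Eventually.of_forall fun b => ?_)
    rw [Real.norm_of_nonneg (hV₁b _ _).1]
    exact (hV₁b _ _).2
  have hV₂si : ∀ a, Integrable (fun b =>
      if p j a * q j b ≤ p j b * q j a then 0 else p j b * q j a) (μ j) := by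
    intro a
    refine Integrable.mono' ((hpi j).mul_const (q j a)) (hV₂m.comp measurable_prodMk_left).aestronglyMeasurable
      (Filter.Eventually.of_forall fun b => ?_)
    rw [Real.norm_of_nonneg (hV₂b _ _).1]
    exact (hV₂b _ _).2
  have hW₁i : Integrable (fun a => ∫ b,
      (if p j a * q j b ≤ p j b * q j a then p j a * q j b else 0) ∂(μ j)) (μ j) :=
    hV₁i.integral_prod_left
  have hW₂i : Integrable (fun a => ∫ b,
      (if p j a * q j b ≤ p j b * q j a then 0 else p j b * q j a) ∂(μ j)) (μ j) :=
    hV₂i.integral_prod_left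
  have hW₁b : ∀ a, 0 ≤ ∫ b, (if p j a * q j b ≤ p j b * q j a then p j a * q j b else 0) ∂(μ j) ∧
      ∫ b, (if p j a * q j b ≤ p j b * q j a then p j a * q j b else 0) ∂(μ j) ≤ p j a := by
    intro a
    refine ⟨integral_nonneg fun b => (hV₁b _ _).1, ?_⟩
    calc ∫ b, (if p j a * q j b ≤ p j b * q j a then p j a * q j b else 0) ∂(μ j)
        ≤ ∫ b, p j a * q j b ∂(μ j) :=
          integral_mono_of_nonneg (Filter.Eventually.of_forall fun b => (hV₁b _ _).1)
            ((hqi j).const_mul (p j a)) (Filter.Eventually.of_forall fun b => (hV₁b _ _).2)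
      _ = p j a := by rw [integral_const_mul, hq1 j, mul_one]
  have hW₂b : ∀ a, 0 ≤ ∫ b, (if p j a * q j b ≤ p j b * q j a then 0 else p j b * q j a) ∂(μ j) ∧
      ∫ b, (if p j a * q j b ≤ p j b * q j a then 0 else p j b * q j a) ∂(μ j) ≤ q j a := by
    intro a
    refine ⟨integral_nonneg fun b => (hV₂b _ _).1, ?_⟩
    calc ∫ b, (if p j a * q j b ≤ p j b * q j a then 0 else p j b * q j a) ∂(μ j)
        ≤ ∫ b, p j b * q j a ∂(μ j) :=
          integral_mono_of_nonneg (Filter.Eventually.of_forall fun b => (hV₂b _ _).1)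
            ((hpi j).mul_const (q j a)) (Filter.Eventually.of_forall fun b => (hV₂b _ _).2)
      _ = q j a := by rw [integral_mul_const, hp1 j, one_mul]
  -- abbreviations for the two majorants `A`, `B` on the product pair space
  -- `A(x, x′) = V₁(xⱼ, x′ⱼ)·∏_{i ≠ j} pᵢ(xᵢ) qᵢ(x′ᵢ)`, `B(x, x′) = V₂(xⱼ, x′ⱼ)·∏_{i ≠ j} pᵢ(x′ᵢ) qᵢ(xᵢ)`
  have hsplitF : ∀ x x' : (i : ι) → X i, (∏ i, p i (x i)) * ∏ i, q i (x' i)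
      = p j (x j) * q j (x' j) * ∏ i ∈ univ.erase j, p i (x i) * q i (x' i) := by
    intro x x'
    rw [← prod_mul_distrib, ← mul_prod_erase univ (fun i => p i (x i) * q i (x' i)) (mem_univ j)]
  have hmaj : ∀ x x' : (i : ι) → X i,
      min ((∏ i, p i (x i)) * ∏ i, q i (x' i)) ((∏ i, p i (x' i)) * ∏ i, q i (x i))
        ≤ (if p j (x j) * q j (x' j) ≤ p j (x' j) * q j (x j) then p j (x j) * q j (x' j) else 0)
            * ∏ i ∈ univ.erase j, p i (x i) * q i (x' i)
          + (if p j (x j) * q j (x' j) ≤ p j (x' j) * q j (x j) then 0 else p j (x' j) * q j (x j))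
            * ∏ i ∈ univ.erase j, p i (x' i) * q i (x i) := by
    intro x x'
    rw [hsplitF x x', hsplitF x' x]
    refine (min_le_ite_add_ite
      (p j (x j) * q j (x' j) * ∏ i ∈ univ.erase j, p i (x i) * q i (x' i))
      (p j (x' j) * q j (x j) * ∏ i ∈ univ.erase j, p i (x' i) * q i (x i))
      (p j (x j) * q j (x' j) ≤ p j (x' j) * q j (x j))).trans (le_of_eq ?_)
    by_cases hc : p j (x j) * q j (x' j) ≤ p j (x' j) * q j (x j)
    · simp only [if_pos hc, zero_mul]
    · simp only [if_neg hc, zero_mul]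
  -- measurability / integrability of the majorants' sections in `x′`
  have hRm : ∀ x : (i : ι) → X i, Measurable (fun x' : (i : ι) → X i =>
      ∏ i ∈ univ.erase j, p i (x i) * q i (x' i)) := fun x =>
    Finset.measurable_prod _ fun i _ => ((hqm i).comp (measurable_pi_apply i)).const_mul _
  have hR'm : ∀ x : (i : ι) → X i, Measurable (fun x' : (i : ι) → X i =>
      ∏ i ∈ univ.erase j, p i (x' i) * q i (x i)) := fun x =>
    Finset.measurable_prod _ fun i _ => ((hpm i).comp (measurable_pi_apply i)).mul_const _
  have hAi : ∀ x : (i : ι) → X i, Integrable (fun x' : (i : ι) → X i =>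
      (if p j (x j) * q j (x' j) ≤ p j (x' j) * q j (x j) then p j (x j) * q j (x' j) else 0)
        * ∏ i ∈ univ.erase j, p i (x i) * q i (x' i)) (Measure.pi μ) := by
    intro x
    refine Integrable.mono' (hQi.const_mul (∏ i, p i (x i)))
      (((hV₁m.comp measurable_prodMk_left).comp (measurable_pi_apply j)).mul (hRm x)).aestronglyMeasurable
      (Filter.Eventually.of_forall fun x' => ?_)
    have hnn : 0 ≤ (if p j (x j) * q j (x' j) ≤ p j (x' j) * q j (x j) then p j (x j) * q j (x' j)
        else 0) * ∏ i ∈ univ.erase j, p i (x i) * q i (x' i) :=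
      mul_nonneg (hV₁b _ _).1 (prod_nonneg fun i _ => mul_nonneg (hp0 _ _) (hq0 _ _))
    rw [Real.norm_of_nonneg hnn, hsplitF x x']
    exact mul_le_mul_of_nonneg_right (hV₁b _ _).2
      (prod_nonneg fun i _ => mul_nonneg (hp0 _ _) (hq0 _ _))
  have hBi : ∀ x : (i : ι) → X i, Integrable (fun x' : (i : ι) → X i =>
      (if p j (x j) * q j (x' j) ≤ p j (x' j) * q j (x j) then 0 else p j (x' j) * q j (x j))
        * ∏ i ∈ univ.erase j, p i (x' i) * q i (x i)) (Measure.pi μ) := by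
    intro x
    refine Integrable.mono' (hPi.mul_const (∏ i, q i (x i)))
      (((hV₂m.comp measurable_prodMk_left).comp (measurable_pi_apply j)).mul (hR'm x)).aestronglyMeasurable
      (Filter.Eventually.of_forall fun x' => ?_)
    have hnn : 0 ≤ (if p j (x j) * q j (x' j) ≤ p j (x' j) * q j (x j) then 0
        else p j (x' j) * q j (x j)) * ∏ i ∈ univ.erase j, p i (x' i) * q i (x i) :=
      mul_nonneg (hV₂b _ _).1 (prod_nonneg fun i _ => mul_nonneg (hp0 _ _) (hq0 _ _))
    rw [Real.norm_of_nonneg hnn, hsplitF x' x]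
    exact mul_le_mul_of_nonneg_right (hV₂b _ _).2
      (prod_nonneg fun i _ => mul_nonneg (hp0 _ _) (hq0 _ _))
  -- inner integrals of the majorants (one-coordinate Fubini, then `∫ qᵢ = 1`, `∫ pᵢ = 1`)
  have hAint : ∀ x : (i : ι) → X i, ∫ x',
      (if p j (x j) * q j (x' j) ≤ p j (x' j) * q j (x j) then p j (x j) * q j (x' j) else 0)
        * ∏ i ∈ univ.erase j, p i (x i) * q i (x' i) ∂(Measure.pi μ)
      = (∫ b, (if p j (x j) * q j b ≤ p j b * q j (x j) then p j (x j) * q j b else 0) ∂(μ j))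
          * ∏ i ∈ univ.erase j, p i (x i) := by
    intro x
    rw [integral_mul_prod_erase_pi j
      (fun b => if p j (x j) * q j b ≤ p j b * q j (x j) then p j (x j) * q j b else 0)
      (fun i b => p i (x i) * q i b)]
    congr 1
    exact prod_congr rfl fun i _ => by rw [integral_const_mul, hq1 i, mul_one]
  have hBint : ∀ x : (i : ι) → X i, ∫ x',
      (if p j (x j) * q j (x' j) ≤ p j (x' j) * q j (x j) then 0 else p j (x' j) * q j (x j))
        * ∏ i ∈ univ.erase j, p i (x' i) * q i (x i) ∂(Measure.pi μ)
      = (∫ b, (if p j (x j) * q j b ≤ p j b * q j (x j) then 0 else p j b * q j (x j)) ∂(μ j))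
          * ∏ i ∈ univ.erase j, q i (x i) := by
    intro x
    rw [integral_mul_prod_erase_pi j
      (fun b => if p j (x j) * q j b ≤ p j b * q j (x j) then 0 else p j b * q j (x j))
      (fun i b => p i b * q i (x i))]
    congr 1
    exact prod_congr rfl fun i _ => by rw [integral_mul_const, hp1 i, one_mul]
  -- the outer majorants are integrable (dominated by `P`, `Q`)
  have hPsplit : ∀ x : (i : ι) → X i, ∏ i, p i (x i) = p j (x j) * ∏ i ∈ univ.erase j, p i (x i) :=
    fun x => (mul_prod_erase univ (fun i => p i (x i)) (mem_univ j)).symm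
  have hQsplit : ∀ x : (i : ι) → X i, ∏ i, q i (x i) = q j (x j) * ∏ i ∈ univ.erase j, q i (x i) :=
    fun x => (mul_prod_erase univ (fun i => q i (x i)) (mem_univ j)).symm
  have hA'i : Integrable (fun x : (i : ι) → X i =>
      (∫ b, (if p j (x j) * q j b ≤ p j b * q j (x j) then p j (x j) * q j b else 0) ∂(μ j))
        * ∏ i ∈ univ.erase j, p i (x i)) (Measure.pi μ) := by
    refine Integrable.mono' hPi
      (((hW₁i.aestronglyMeasurable.aemeasurable.comp_quasiMeasurePreserving
        (Measure.quasiMeasurePreserving_eval μ j)).mul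
        (Finset.measurable_prod _ fun i _ =>
          (hpm i).comp (measurable_pi_apply i)).aemeasurable).aestronglyMeasurable)
      (Filter.Eventually.of_forall fun x => ?_)
    rw [Real.norm_of_nonneg (mul_nonneg (hW₁b _).1 (prod_nonneg fun i _ => hp0 _ _)), hPsplit x]
    exact mul_le_mul_of_nonneg_right (hW₁b _).2 (prod_nonneg fun i _ => hp0 _ _)
  have hB'i : Integrable (fun x : (i : ι) → X i =>
      (∫ b, (if p j (x j) * q j b ≤ p j b * q j (x j) then 0 else p j b * q j (x j)) ∂(μ j))
        * ∏ i ∈ univ.erase j, q i (x i)) (Measure.pi μ) := by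
    refine Integrable.mono' hQi
      (((hW₂i.aestronglyMeasurable.aemeasurable.comp_quasiMeasurePreserving
        (Measure.quasiMeasurePreserving_eval μ j)).mul
        (Finset.measurable_prod _ fun i _ =>
          (hqm i).comp (measurable_pi_apply i)).aemeasurable).aestronglyMeasurable)
      (Filter.Eventually.of_forall fun x => ?_)
    rw [Real.norm_of_nonneg (mul_nonneg (hW₂b _).1 (prod_nonneg fun i _ => hq0 _ _)), hQsplit x]
    exact mul_le_mul_of_nonneg_right (hW₂b _).2 (prod_nonneg fun i _ => hq0 _ _)
  -- assemble: inner bound, outer bound, one-coordinate Fubini on the outer integrals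
  have inner : ∀ x : (i : ι) → X i,
      ∫ x', min ((∏ i, p i (x i)) * ∏ i, q i (x' i)) ((∏ i, p i (x' i)) * ∏ i, q i (x i))
          ∂(Measure.pi μ)
        ≤ (∫ b, (if p j (x j) * q j b ≤ p j b * q j (x j) then p j (x j) * q j b else 0) ∂(μ j))
            * ∏ i ∈ univ.erase j, p i (x i)
          + (∫ b, (if p j (x j) * q j b ≤ p j b * q j (x j) then 0 else p j b * q j (x j)) ∂(μ j))
            * ∏ i ∈ univ.erase j, q i (x i) := by
    intro x
    rw [← hAint x, ← hBint x, ← integral_add (hAi x) (hBi x)]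
    exact integral_mono_of_nonneg (Filter.Eventually.of_forall fun x' => hKnn _ _)
      ((hAi x).add (hBi x)) (Filter.Eventually.of_forall fun x' => hmaj x x')
  have houtA : ∫ x, (∫ b, (if p j (x j) * q j b ≤ p j b * q j (x j) then p j (x j) * q j b
      else 0) ∂(μ j)) * ∏ i ∈ univ.erase j, p i (x i) ∂(Measure.pi μ)
      = ∫ a, ∫ b, (if p j a * q j b ≤ p j b * q j a then p j a * q j b else 0) ∂(μ j) ∂(μ j) := by
    rw [integral_mul_prod_erase_pi j (fun a => ∫ b,
        (if p j a * q j b ≤ p j b * q j a then p j a * q j b else 0) ∂(μ j)) (fun i a => p i a),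
      prod_eq_one fun i _ => hp1 i, mul_one]
  have houtB : ∫ x, (∫ b, (if p j (x j) * q j b ≤ p j b * q j (x j) then 0
      else p j b * q j (x j)) ∂(μ j)) * ∏ i ∈ univ.erase j, q i (x i) ∂(Measure.pi μ)
      = ∫ a, ∫ b, (if p j a * q j b ≤ p j b * q j a then 0 else p j b * q j a) ∂(μ j) ∂(μ j) := by
    rw [integral_mul_prod_erase_pi j (fun a => ∫ b,
        (if p j a * q j b ≤ p j b * q j a then 0 else p j b * q j a) ∂(μ j)) (fun i a => q i a),
      prod_eq_one fun i _ => hq1 i, mul_one]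
  calc ∫ x, ∫ x', min ((∏ i, p i (x i)) * ∏ i, q i (x' i)) ((∏ i, p i (x' i)) * ∏ i, q i (x i))
          ∂(Measure.pi μ) ∂(Measure.pi μ)
      ≤ ∫ x, ((∫ b, (if p j (x j) * q j b ≤ p j b * q j (x j) then p j (x j) * q j b else 0) ∂(μ j))
            * ∏ i ∈ univ.erase j, p i (x i)
          + (∫ b, (if p j (x j) * q j b ≤ p j b * q j (x j) then 0 else p j b * q j (x j)) ∂(μ j))
            * ∏ i ∈ univ.erase j, q i (x i)) ∂(Measure.pi μ) :=
        integral_mono_of_nonneg (Filter.Eventually.of_forall fun x => integral_nonneg fun x' =>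
          hKnn _ _) (hA'i.add hB'i) (Filter.Eventually.of_forall inner)
    _ = (∫ a, ∫ b, (if p j a * q j b ≤ p j b * q j a then p j a * q j b else 0) ∂(μ j) ∂(μ j))
          + ∫ a, ∫ b, (if p j a * q j b ≤ p j b * q j a then 0 else p j b * q j a) ∂(μ j) ∂(μ j) := by
        rw [integral_add hA'i hB'i, houtA, houtB]
    _ = ∫ a, ((∫ b, (if p j a * q j b ≤ p j b * q j a then p j a * q j b else 0) ∂(μ j))
          + ∫ b, (if p j a * q j b ≤ p j b * q j a then 0 else p j b * q j a) ∂(μ j)) ∂(μ j) :=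
        (integral_add hW₁i hW₂i).symm
    _ = ∫ a, ∫ b, min (p j a * q j b) (p j b * q j a) ∂(μ j) ∂(μ j) := by
        refine integral_congr_ae (Filter.Eventually.of_forall fun a => ?_)
        show (∫ b, (if p j a * q j b ≤ p j b * q j a then p j a * q j b else 0) ∂(μ j))
          + ∫ b, (if p j a * q j b ≤ p j b * q j a then 0 else p j b * q j a) ∂(μ j)
            = ∫ b, min (p j a * q j b) (p j b * q j a) ∂(μ j)
        rw [← integral_add (hV₁si a) (hV₂si a)]
        exact integral_congr_ae (Filter.Eventually.of_forall fun b => ite_add_ite_eq_min _ _)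

/-- **THE ACCEPTANCE VOLUME SANDWICH (`m` blocks, general space).**  For normalised nonnegative
block targets and models, `∏ᵢ acc(pᵢ, qᵢ) ≤ acc(⊗pᵢ, ⊗qᵢ) ≤ acc(pⱼ, qⱼ)` for every block `j`.
[ours] -/
theorem meanAccept_pi_sandwich {p q : (i : ι) → X i → ℝ} (hp0 : ∀ i a, 0 ≤ p i a)
    (hpm : ∀ i, Measurable (p i)) (hpi : ∀ i, Integrable (p i) (μ i))
    (hp1 : ∀ i, ∫ a, p i a ∂(μ i) = 1) (hq0 : ∀ i a, 0 ≤ q i a) (hqm : ∀ i, Measurable (q i))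
    (hqi : ∀ i, Integrable (q i) (μ i)) (hq1 : ∀ i, ∫ a, q i a ∂(μ i) = 1) (j : ι) :
    ∏ i, (∫ a, ∫ b, min (p i a * q i b) (p i b * q i a) ∂(μ i) ∂(μ i))
      ≤ ∫ x, ∫ x', min ((∏ i, p i (x i)) * ∏ i, q i (x' i)) ((∏ i, p i (x' i)) * ∏ i, q i (x i))
          ∂(Measure.pi μ) ∂(Measure.pi μ) ∧
    ∫ x, ∫ x', min ((∏ i, p i (x i)) * ∏ i, q i (x' i)) ((∏ i, p i (x' i)) * ∏ i, q i (x i))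
          ∂(Measure.pi μ) ∂(Measure.pi μ)
      ≤ ∫ a, ∫ b, min (p j a * q j b) (p j b * q j a) ∂(μ j) ∂(μ j) :=
  ⟨prod_meanAccept_le_meanAccept_pi hp0 hpm hpi hq0 hqm hqi,
    meanAccept_pi_le_meanAccept_coord hp0 hpm hpi hp1 hq0 hqm hqi hq1 j⟩

/-! ## Identical blocks -/

section Const

variable {Y : Type*} [MeasurableSpace Y] {ν : Measure Y} [SigmaFinite ν]

/-- **Identical blocks, ceiling**: `acc(p^{⊗m}, q^{⊗m}) ≤ acc(p, q)` once there is a block at all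
(`ι` nonempty; for `m = 0` the left side is `1`). [ours] -/
theorem meanAccept_pi_const_le [Nonempty ι] {p q : Y → ℝ} (hp0 : ∀ a, 0 ≤ p a)
    (hpm : Measurable p) (hpi : Integrable p ν) (hp1 : ∫ a, p a ∂ν = 1) (hq0 : ∀ a, 0 ≤ q a)
    (hqm : Measurable q) (hqi : Integrable q ν) (hq1 : ∫ a, q a ∂ν = 1) :
    ∫ x, ∫ x', min ((∏ i : ι, p (x i)) * ∏ i, q (x' i)) ((∏ i, p (x' i)) * ∏ i, q (x i))
          ∂(Measure.pi fun _ : ι => ν) ∂(Measure.pi fun _ : ι => ν)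
      ≤ ∫ a, ∫ b, min (p a * q b) (p b * q a) ∂ν ∂ν :=
  meanAccept_pi_le_meanAccept_coord (ι := ι) (μ := fun _ : ι => ν) (p := fun _ => p)
    (q := fun _ => q) (fun _ => hp0) (fun _ => hpm) (fun _ => hpi) (fun _ => hp1) (fun _ => hq0)
    (fun _ => hqm) (fun _ => hqi) (fun _ => hq1) (Classical.arbitrary ι)

end Const

end Summit.Ventures.LatticeQCDFlow.Theory2
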